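import Summits.NavierStokesRegularity.NavierStokesRegularity.Theorems.TypeICertificateLadderTargetFiveHalvesWindowAprioriDecay
import Summits.NavierStokesRegularity.NavierStokesRegularity.Theorems.TypeICertificateLadderTargetFiveHalvesWindowRateStep

/-!
# Crux `Target` = `TypeICertificateLadder.NoTypeIBlowup` (stmt-NavierStokesRegularity-1217): the
# `q = 5/2` WINDOW of the ladder — RUNGS `X_C` FOR EVERY `C < √(16/15)`

`--supports stmt-NavierStokesRegularity-1217`. The crux is `∀ C, X_C` (`LadderGlue`); the tree's
kernel reach was rung one `X_1` (`typeICertificateLadder_rungReynoldsOne`, stmt-2882), while the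
bookkeeping of the same `q = 5/2` budget closes `X_C` for every `C² < 16/15`
(`RungReynoldsOne/Negative/BudgetCeiling.lean`: window of the `L^q` method `C < √6 − √2`, never
beyond). This file turns that bookkeeping into kernel theorems:

  `rung_of_sq_lt        : 0 < C → C² < 22/21 → X_C`  (one bootstrap step, `√(22/21) = 1.0235…`),
  `rung_of_sq_lt_window : 0 < C → C² < 16/15 → X_C`  (full window,        `√(16/15) = 1.0327…`),

i.e. every classical solution of the unforced Navier–Stokes system on `ℝ³ × [0,T)` which is
Leray–Hopf from its rapidly decaying datum and whose collapse Reynolds number is eventually at most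
`C`, `√(T−t)‖u(t,x)‖ ≤ C√ν`, extends smoothly past `T`, for every `C < √(16/15)`.

Proof: the rate-`C` a-priori power rates `∫F(curl u) ≤ K₁(T−t)^{-15C²/16}`,
`∫|∇u|² ≤ K₂(T−t)^{-C²/2}`, `|u|² ≤ M/(T−t)` (`FiveHalvesWindow.aprioriDecay_rate`) fed once into the
generic rate step (`FiveHalvesWindow.enstrophyDecay_step`, rung one's Lamb-form enstrophy slab
inequality `stub_enstrophyLambSlab` on the Tao cover `stub_taoCover`) give
`‖u(t)‖₂² + ‖∇u(t)‖₂² ≤ K(T−t)^{-(21C²/20 − 3/5)}` on `[T/2,T)` (for `C² > 4/7`, so that the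
production exponent exceeds one); at a singular time Tao's `H¹` lifespan bound forces
`(‖u(t)‖₂² + ‖∇u(t)‖₂²)²(T−t) ≥ cν³` (`stub_h1BlowupRate`), impossible when `21C²/20 − 3/5 < 1/2`,
i.e. `C² < 22/21` (`hasSmoothExtensionPast_of_decay`); for `C² ≤ 4/7 < 1` rung one applies
directly. ITERATING the rate step on its own output (`zRate_of_Ico` re-feeds the `H¹` growth bound
as an enstrophy rate on `(0,T)`; `zRate_bootstrap`) drives the exponent along
`b_{n+1} = 3b_n/5 + 3C²/4 − 3/5` to the fixed point `15C²/8 − 3/2`, which is `< 1/2` iff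
`C² < 16/15`: the full window (`rung_of_sq_lt_window`, `rung_10327`).
WHAT THIS IS NOT: not the crux (every `C`), not beyond the `√6 − √2` ceiling of the `κ = 1` budgets;
a 3.3 % extension of the kernel reach of the ladder, by the method `BudgetCeiling` certifies to reach
3.5 % (its supremum over `q`, attained at `q* = (3+√3)/2`, would need the `|ω|^{q*−2}` weight).
[folklore: Grönwall bookkeeping on landed slab inequalities]
-/

noncomputable section

open Set Filter Topology MeasureTheory
open scoped RealInnerProductSpace ENNReal NNReal Laplacian ContDiff
open Literature.Analysis.FluidPDE

namespace Summit.NavierStokesRegularity.NavierStokesRegularity.Theorems.FiveHalvesWindow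

-- the problem directory `NavierStokesRegularity/NavierStokesRegularity` forces the duplicated namespace
set_option linter.dupNamespace false

open Summit.NavierStokesRegularity.NavierStokesRegularity.Theorems.RungReynoldsOne

/-- **Subcritical `H¹` growth contradicts a singular time.** If along a classical Leray–Hopf
rapidly-decaying-datum solution on `ℝ³ × [0,T)` one has `‖u(t)‖₂² + ‖∇u(t)‖₂² ≤ K (T−t)^{-γ}` on
`[t₀, T)` with `γ < 1/2`, then the solution extends smoothly past `T`: otherwise Tao's `H¹` lifespan
bound (`stub_h1BlowupRate`: `cν³ ≤ (‖u(t)‖₂²+‖∇u(t)‖₂²)²(T−t)` on `[0,T)`) gives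
`cν³ ≤ K²(T−t)^{1−2γ} → 0`. (Generic-exponent form of `rungReynoldsOne_of_decay_of_rate`.) -/
theorem hasSmoothExtensionPast_of_decay {ν T : ℝ} (hν : 0 < ν) (hT : 0 < T)
    {u : ℝ → EuclideanSpace ℝ (Fin 3) → EuclideanSpace ℝ (Fin 3)}
    {p : ℝ → EuclideanSpace ℝ (Fin 3) → ℝ}
    (hcl : IsClassicalNSSolutionOn (Ico 0 T) ν 0 u p) (hLH : IsLerayHopfOn T ν 0 (u 0) u)
    (hdec : HasRapidSpatialDecay (u 0)) {γ K t₀ : ℝ} (hγ : γ < 1 / 2) (ht₀ : t₀ ∈ Ico 0 T)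
    (hK : ∀ t ∈ Ico t₀ T,
      (∫⁻ x, ‖u t x‖ₑ ^ 2) + ∫⁻ x, ENNReal.ofReal (frobeniusNormSq (fderiv ℝ (u t) x)) ≤
        ENNReal.ofReal (K * (T - t) ^ (-γ))) :
    HasSmoothExtensionPast ν 0 u T := by
  by_contra hext
  obtain ⟨c, hc, hlow⟩ := stub_h1BlowupRate
  have hlow' := hlow hν hT hcl hLH hdec hext
  have hcν : 0 < c * ν ^ 3 := mul_pos hc (pow_pos hν 3)
  have hsmall : ∀ᶠ t in 𝓝[<] T, K ^ 2 * (T - t) ^ (1 - 2 * γ) < c * ν ^ 3 :=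
    (tendsto_order.1 (rungReynoldsOne_tendsto_sq_mul_rpow_sub (T := T) (K := K) hγ)).2 _ hcν
  have hIco : ∀ᶠ t in 𝓝[<] T, t ∈ Ico t₀ T := Ico_mem_nhdsLT ht₀.2
  obtain ⟨t, ht, hsmallt⟩ := (hIco.and hsmall).exists
  have htT : t ∈ Ico 0 T := ⟨ht₀.1.trans ht.1, ht.2⟩
  have hTt : 0 < T - t := sub_pos.2 ht.2
  have hup := hK t ht
  have hlo := hlow' t htT
  have hnn : 0 ≤ max K 0 * (T - t) ^ (-γ) :=
    mul_nonneg (le_max_right _ _) (Real.rpow_nonneg hTt.le _)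
  have hup' : (∫⁻ x, ‖u t x‖ₑ ^ 2) + ∫⁻ x, ENNReal.ofReal (frobeniusNormSq (fderiv ℝ (u t) x)) ≤
      ENNReal.ofReal (max K 0 * (T - t) ^ (-γ)) := by
    refine hup.trans (ENNReal.ofReal_le_ofReal ?_)
    exact mul_le_mul_of_nonneg_right (le_max_left _ _) (Real.rpow_nonneg hTt.le _)
  have hchain : ENNReal.ofReal (c * ν ^ 3) ≤
      ENNReal.ofReal ((max K 0) ^ 2 * (T - t) ^ (1 - 2 * γ)) := by
    calc ENNReal.ofReal (c * ν ^ 3)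
        ≤ ((∫⁻ x, ‖u t x‖ₑ ^ 2) + ∫⁻ x, ENNReal.ofReal (frobeniusNormSq (fderiv ℝ (u t) x))) ^ 2 *
            ENNReal.ofReal (T - t) := hlo
      _ ≤ (ENNReal.ofReal (max K 0 * (T - t) ^ (-γ))) ^ 2 * ENNReal.ofReal (T - t) := by
          gcongr
      _ = ENNReal.ofReal ((max K 0 * (T - t) ^ (-γ)) ^ 2 * (T - t)) := by
          rw [ENNReal.ofReal_mul (sq_nonneg _), ENNReal.ofReal_pow hnn]
      _ = ENNReal.ofReal ((max K 0) ^ 2 * (T - t) ^ (1 - 2 * γ)) := by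
          rw [rungReynoldsOne_sq_mul_rpow_neg_mul hTt]
  have hnn' : 0 ≤ (max K 0) ^ 2 * (T - t) ^ (1 - 2 * γ) :=
    mul_nonneg (sq_nonneg _) (Real.rpow_nonneg hTt.le _)
  have h1 := (ENNReal.ofReal_le_ofReal_iff hnn').1 hchain
  have h2 : (max K 0) ^ 2 ≤ K ^ 2 := by
    rcases le_total K 0 with hK0 | hK0
    · rw [max_eq_right hK0]; simpa using sq_nonneg K
    · rw [max_eq_left hK0]
  have h3 : (max K 0) ^ 2 * (T - t) ^ (1 - 2 * γ) ≤ K ^ 2 * (T - t) ^ (1 - 2 * γ) :=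
    mul_le_mul_of_nonneg_right h2 (Real.rpow_nonneg hTt.le _)
  linarith

/-- **One bootstrap step of the `q = 5/2` window: subcritical `H¹` growth under collapse Reynolds
number `C`, `4/7 < C²`.** Along every classical Leray–Hopf rapidly-decaying-datum solution on
`ℝ³ × [0,T)` with eventual rate `√(T−t)‖u(t,x)‖ ≤ C√ν` there is `K` with
`‖u(t)‖₂² + ‖∇u(t)‖₂² ≤ K (T−t)^{-(21C²/20 − 3/5)}` on `[T/2, T)` (the rate-`C` a-priori rates
`α = 15C²/16`, `β = C²/2` fed once into `enstrophyDecay_step`; `4/7 < C²` makes the production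
exponent `2/5 + 21C²/20` exceed one). -/
theorem enstrophyDecay_rate {ν T C : ℝ} (hν : 0 < ν) (hT : 0 < T) (hC0 : 0 < C)
    (hC47 : 4 / 7 < C ^ 2)
    {u : ℝ → EuclideanSpace ℝ (Fin 3) → EuclideanSpace ℝ (Fin 3)}
    {p : ℝ → EuclideanSpace ℝ (Fin 3) → ℝ}
    (hsol : IsClassicalNSSolutionOn (Ico 0 T) ν 0 u p) (hLH : IsLerayHopfOn T ν 0 (u 0) u)
    (hdec : HasRapidSpatialDecay (u 0))
    (hrate : ∀ᶠ t in 𝓝[<] T, ∀ x, Real.sqrt (T - t) * ‖u t x‖ ≤ C * Real.sqrt ν) :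
    ∃ K : ℝ, ∀ t ∈ Ico (T / 2) T,
      (∫⁻ x, ‖u t x‖ₑ ^ 2) + ∫⁻ x, ENNReal.ofReal (frobeniusNormSq (fderiv ℝ (u t) x)) ≤
        ENNReal.ofReal (K * (T - t) ^ (-(21 * C ^ 2 / 20 - 3 / 5))) := by
  obtain ⟨K₁, K₂, M, hb⟩ := aprioriDecay_rate hν hT hC0 hsol hLH hdec hrate
  have he : 1 < (2 + 3 * (C ^ 2 / 2)) / 5 + 4 * (15 * C ^ 2 / 16) / 5 := by nlinarith
  obtain ⟨K, hK⟩ := enstrophyDecay_step stub_enstrophyLambSlab stub_taoCover hν hT hsol hLH hdec he hb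
  refine ⟨K, fun t ht => (hK t ht).trans_eq ?_⟩
  congr 3
  ring

/-- **Rungs `X_C` of the Type-I certificate ladder for every `C < √(22/21)`** (`√(22/21) = 1.0235…`;
the tree's previous kernel reach was `C = 1`, `typeICertificateLadder_rungReynoldsOne`): every
classical solution of the unforced Navier–Stokes system on `ℝ³ × [0,T)` which is Leray–Hopf from its
rapidly decaying datum and whose collapse Reynolds number is eventually at most `C`,
`√(T−t)‖u(t,x)‖ ≤ C√ν` for all `x` and all `t < T` near `T`, extends smoothly past `T` — for every
`0 < C` with `C² < 22/21`. For `C² ≤ 4/7` this is rung one (the rate is then `≤ √ν`); for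
`4/7 < C² < 22/21` the one-step subcritical growth exponent `21C²/20 − 3/5` is `< 1/2`. -/
theorem rung_of_sq_lt {C : ℝ} (hC0 : 0 < C) (hC : C ^ 2 < 22 / 21) :
    ∀ (ν T : ℝ), 0 < ν → 0 < T →
      ∀ (u : ℝ → EuclideanSpace ℝ (Fin 3) → EuclideanSpace ℝ (Fin 3))
        (p : ℝ → EuclideanSpace ℝ (Fin 3) → ℝ),
      IsClassicalNSSolutionOn (Set.Ico 0 T) ν 0 u p → IsLerayHopfOn T ν 0 (u 0) u →
      HasRapidSpatialDecay (u 0) →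
      (∀ᶠ t in 𝓝[<] T, ∀ x, Real.sqrt (T - t) * ‖u t x‖ ≤ C * Real.sqrt ν) →
      HasSmoothExtensionPast ν 0 u T := by
  intro ν T hν hT u p hcl hLH hdec hrate
  by_cases hC47 : 4 / 7 < C ^ 2
  · obtain ⟨K, hK⟩ := enstrophyDecay_rate hν hT hC0 hC47 hcl hLH hdec hrate
    have hγ : 21 * C ^ 2 / 20 - 3 / 5 < 1 / 2 := by linarith
    exact hasSmoothExtensionPast_of_decay hν hT hcl hLH hdec hγ ⟨by linarith, by linarith⟩ hK
  · -- `C² ≤ 4/7 < 1`: the rate is at most `√ν`, rung one applies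
    have hC1 : C ≤ 1 := by nlinarith
    have hrate1 : ∀ᶠ t in 𝓝[<] T, ∀ x, Real.sqrt (T - t) * ‖u t x‖ ≤ Real.sqrt ν := by
      filter_upwards [hrate] with t ht x
      exact (ht x).trans (by nlinarith [Real.sqrt_nonneg ν])
    exact typeICertificateLadder_rungReynoldsOne ν T hν hT u p hcl hLH hdec hrate1

/-! ## Iterating the rate step: the full `q = 5/2` window `C² < 16/15` -/

/-- **From an `H¹` growth bound near `T` to an enstrophy rate on all of `(0,T)`.** If
`‖u(t)‖₂² + ‖∇u(t)‖₂² ≤ K(T−t)^{-γ}` on `[T/2, T)` (`γ ≥ 0`), then, the enstrophy being bounded on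
`[0, T/2]` by the Tao-class bounds of the cover (`stub_taoCover`), `∫|∇u(t)|²_F ≤ K'(T−t)^{-γ}` on
`(0,T)`. -/
theorem zRate_of_Ico {ν T : ℝ} (hν : 0 < ν) (hT : 0 < T)
    {u : ℝ → EuclideanSpace ℝ (Fin 3) → EuclideanSpace ℝ (Fin 3)}
    {p : ℝ → EuclideanSpace ℝ (Fin 3) → ℝ}
    (hsol : IsClassicalNSSolutionOn (Ico 0 T) ν 0 u p) (hLH : IsLerayHopfOn T ν 0 (u 0) u)
    (hdec : HasRapidSpatialDecay (u 0)) {γ K : ℝ} (hγ : 0 ≤ γ)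
    (hK : ∀ t ∈ Ico (T / 2) T,
      (∫⁻ x, ‖u t x‖ₑ ^ 2) + ∫⁻ x, ENNReal.ofReal (frobeniusNormSq (fderiv ℝ (u t) x)) ≤
        ENNReal.ofReal (K * (T - t) ^ (-γ))) :
    ∃ K' : ℝ, ∀ t ∈ Ioo 0 T,
      ∫⁻ x, ENNReal.ofReal (frobeniusNormSq (fderiv ℝ (u t) x)) ≤
        ENNReal.ofReal (K' * (T - t) ^ (-γ)) := by
  have hT2 : T / 2 ∈ Ioo 0 T := ⟨by linarith, by linarith⟩
  obtain ⟨q₀, -, hu₀, -, -⟩ := stub_taoCover hν hT hsol hLH hdec hT2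
  obtain ⟨C₁, hC₁⟩ := hu₀ 1
  refine ⟨max K 0 + 3 * (C₁ : ℝ) * T ^ γ, fun t ht => ?_⟩
  have hTt : 0 < T - t := sub_pos.2 ht.2
  have hpow0 : 0 ≤ (T - t) ^ (-γ) := Real.rpow_nonneg hTt.le _
  -- `1 ≤ T^γ (T−t)^{-γ}` on `(0,T)`
  have hone : 1 ≤ T ^ γ * (T - t) ^ (-γ) := by
    have h1 : T ^ (-γ) ≤ (T - t) ^ (-γ) := by
      rw [Real.rpow_neg hTt.le, Real.rpow_neg hT.le]
      exact inv_anti₀ (Real.rpow_pos_of_pos hTt _)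
        (Real.rpow_le_rpow hTt.le (by linarith [ht.1]) hγ)
    have h2 : T ^ γ * T ^ (-γ) = 1 := by
      rw [Real.rpow_neg hT.le, mul_inv_cancel₀ (Real.rpow_pos_of_pos hT _).ne']
    calc (1 : ℝ) = T ^ γ * T ^ (-γ) := h2.symm
      _ ≤ T ^ γ * (T - t) ^ (-γ) := mul_le_mul_of_nonneg_left h1 (Real.rpow_nonneg hT.le _)
  have hC₁0 : 0 ≤ (C₁ : ℝ) := NNReal.coe_nonneg _
  by_cases hlt : t < T / 2
  · -- before `T/2`: the Tao-class bound `∫|∇u(t)|²_F ≤ 3 C₁`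
    have hG : ∫⁻ x, ENNReal.ofReal (frobeniusNormSq (fderiv ℝ (u t) x)) ≤ 3 * C₁ := by
      calc ∫⁻ x, ENNReal.ofReal (frobeniusNormSq (fderiv ℝ (u t) x))
          ≤ ∫⁻ x, 3 * ‖iteratedFDeriv ℝ 1 (u t) x‖ₑ ^ 2 := lintegral_mono fun x => by
            rw [← ofReal_norm, norm_iteratedFDeriv_one, ofReal_norm]
            exact ofReal_frobeniusNormSq_le_three_mul_enorm_sq _
        _ = 3 * ∫⁻ x, ‖iteratedFDeriv ℝ 1 (u t) x‖ₑ ^ 2 := lintegral_const_mul' _ _ (by norm_num)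
        _ ≤ 3 * C₁ := by gcongr; exact hC₁ t ⟨ht.1.le, hlt.le⟩
    refine hG.trans ?_
    have h3 : (3 : ℝ≥0∞) * C₁ = ENNReal.ofReal (3 * (C₁ : ℝ)) := by
      rw [ENNReal.ofReal_mul (by norm_num), ENNReal.ofReal_coe_nnreal, ENNReal.ofReal_ofNat]
    rw [h3]
    refine ENNReal.ofReal_le_ofReal ?_
    have h4 : 3 * (C₁ : ℝ) ≤ 3 * (C₁ : ℝ) * (T ^ γ * (T - t) ^ (-γ)) :=
      le_mul_of_one_le_right (by positivity) hone
    nlinarith [h4, hpow0, le_max_right K 0, mul_nonneg (le_max_right K 0) hpow0]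
  · have ht' : t ∈ Ico (T / 2) T := ⟨not_lt.1 hlt, ht.2⟩
    calc ∫⁻ x, ENNReal.ofReal (frobeniusNormSq (fderiv ℝ (u t) x))
        ≤ (∫⁻ x, ‖u t x‖ₑ ^ 2) + ∫⁻ x, ENNReal.ofReal (frobeniusNormSq (fderiv ℝ (u t) x)) :=
          le_add_self
      _ ≤ ENNReal.ofReal (K * (T - t) ^ (-γ)) := hK t ht'
      _ ≤ ENNReal.ofReal ((max K 0 + 3 * (C₁ : ℝ) * T ^ γ) * (T - t) ^ (-γ)) := by
          refine ENNReal.ofReal_le_ofReal ?_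
          have h5 : 0 ≤ 3 * (C₁ : ℝ) * T ^ γ := by positivity
          nlinarith [le_max_left K 0, hpow0, h5, mul_nonneg h5 hpow0]

/-! The bootstrap exponents are `b_n = β* + (3/5)^n (C²/2 − β*)`, `β* = 15C²/8 − 3/2` the fixed
point of `b ↦ 3b/5 + 3C²/4 − 3/5` (the output exponent of `enstrophyDecay_step` with `α = 15C²/16`,
`β = b`); `b₀ = C²/2`, and `C²/2 − β* = 3/2 − 11C²/8`. They are written out explicitly below (no
auxiliary definition). -/

/-- The recursion `b_{n+1} = 3b_n/5 + 3C²/4 − 3/5` of the explicit exponents. -/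
theorem bootExp_succ (C : ℝ) (n : ℕ) :
    (15 * C ^ 2 / 8 - 3 / 2 + (3 / 5 : ℝ) ^ (n + 1) * (3 / 2 - 11 * C ^ 2 / 8)) =
      3 * (15 * C ^ 2 / 8 - 3 / 2 + (3 / 5 : ℝ) ^ n * (3 / 2 - 11 * C ^ 2 / 8)) / 5 +
        3 * C ^ 2 / 4 - 3 / 5 := by
  rw [pow_succ]; ring

/-- `b₀ = C²/2`. -/
theorem bootExp_zero (C : ℝ) :
    (15 * C ^ 2 / 8 - 3 / 2 + (3 / 5 : ℝ) ^ (0 : ℕ) * (3 / 2 - 11 * C ^ 2 / 8)) = C ^ 2 / 2 := by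
  rw [pow_zero]; ring

/-- The exponents stay above the fixed point (for `C²/2 ≥ β*`, i.e. `C² ≤ 12/11`). -/
theorem fixedPoint_le_bootExp {C : ℝ} (hC : C ^ 2 ≤ 12 / 11) (n : ℕ) :
    15 * C ^ 2 / 8 - 3 / 2 ≤ (15 * C ^ 2 / 8 - 3 / 2 + (3 / 5 : ℝ) ^ n * (3 / 2 - 11 * C ^ 2 / 8)) := by
  have h1 : 0 ≤ 3 / 2 - 11 * C ^ 2 / 8 := by linarith
  have h2 : 0 ≤ (3 / 5 : ℝ) ^ n := by positivity
  nlinarith [mul_nonneg h2 h1]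

/-- **The bootstrap.** Under collapse Reynolds number `C` with `4/5 < C² ≤ 12/11`, for every `n` the
enstrophy obeys `∫|∇u(t)|²_F ≤ K_n (T−t)^{-b_n}` on `(0,T)` (induction on `n`: the rate-`C` a-priori
rates give `b₀ = C²/2`; `enstrophyDecay_step` with `β = b_n` — its production exponent
`2/5 + 3b_n/5 + 3C²/4` exceeds one because `b_n ≥ β* > 1 − 5C²/4` — and `zRate_of_Ico` give
`b_{n+1}`). -/
theorem zRate_bootstrap {ν T C : ℝ} (hν : 0 < ν) (hT : 0 < T) (hC0 : 0 < C)
    (hC45 : 4 / 5 < C ^ 2) (hC12 : C ^ 2 ≤ 12 / 11)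
    {u : ℝ → EuclideanSpace ℝ (Fin 3) → EuclideanSpace ℝ (Fin 3)}
    {p : ℝ → EuclideanSpace ℝ (Fin 3) → ℝ}
    (hsol : IsClassicalNSSolutionOn (Ico 0 T) ν 0 u p) (hLH : IsLerayHopfOn T ν 0 (u 0) u)
    (hdec : HasRapidSpatialDecay (u 0))
    (hrate : ∀ᶠ t in 𝓝[<] T, ∀ x, Real.sqrt (T - t) * ‖u t x‖ ≤ C * Real.sqrt ν) (n : ℕ) :
    (∃ K : ℝ, ∀ t ∈ Ioo 0 T,
      ∫⁻ x, ENNReal.ofReal (frobeniusNormSq (fderiv ℝ (u t) x)) ≤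
        ENNReal.ofReal (K * (T - t) ^ (-(15 * C ^ 2 / 8 - 3 / 2 + (3 / 5 : ℝ) ^ n * (3 / 2 - 11 * C ^ 2 / 8))))) ∧
    (∃ K : ℝ, ∀ t ∈ Ico (T / 2) T,
      (∫⁻ x, ‖u t x‖ₑ ^ 2) + ∫⁻ x, ENNReal.ofReal (frobeniusNormSq (fderiv ℝ (u t) x)) ≤
        ENNReal.ofReal (K * (T - t) ^ (-(15 * C ^ 2 / 8 - 3 / 2 + (3 / 5 : ℝ) ^ (n + 1) * (3 / 2 - 11 * C ^ 2 / 8))))) := by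
  obtain ⟨K₁, K₂, M, hb⟩ := aprioriDecay_rate hν hT hC0 hsol hLH hdec hrate
  -- the step at stage `n` from a `Z`-rate with exponent `b_n`
  have step : ∀ n : ℕ, ∀ K : ℝ, (∀ t ∈ Ioo 0 T,
      ∫⁻ x, ENNReal.ofReal (frobeniusNormSq (fderiv ℝ (u t) x)) ≤
        ENNReal.ofReal (K * (T - t) ^ (-(15 * C ^ 2 / 8 - 3 / 2 + (3 / 5 : ℝ) ^ n * (3 / 2 - 11 * C ^ 2 / 8))))) →
      ∃ K' : ℝ, ∀ t ∈ Ico (T / 2) T,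
        (∫⁻ x, ‖u t x‖ₑ ^ 2) + ∫⁻ x, ENNReal.ofReal (frobeniusNormSq (fderiv ℝ (u t) x)) ≤
          ENNReal.ofReal (K' * (T - t) ^ (-(15 * C ^ 2 / 8 - 3 / 2 + (3 / 5 : ℝ) ^ (n + 1) * (3 / 2 - 11 * C ^ 2 / 8)))) := by
    intro n K hK
    have hfix := fixedPoint_le_bootExp hC12 n
    have he : 1 < (2 + 3 * (15 * C ^ 2 / 8 - 3 / 2 + (3 / 5 : ℝ) ^ n * (3 / 2 - 11 * C ^ 2 / 8))) / 5 + 4 * (15 * C ^ 2 / 16) / 5 := by nlinarith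
    have hb' : ∀ t ∈ Ioo 0 T,
        (∫⁻ x, ENNReal.ofReal ((‖curl (u t) x‖ ^ 2 + 1) ^ (5 / 4 : ℝ) - 1) ≤
          ENNReal.ofReal (K₁ * (T - t) ^ (-(15 * C ^ 2 / 16)))) ∧
        (∫⁻ x, ENNReal.ofReal (frobeniusNormSq (fderiv ℝ (u t) x)) ≤
          ENNReal.ofReal (K * (T - t) ^ (-(15 * C ^ 2 / 8 - 3 / 2 + (3 / 5 : ℝ) ^ n * (3 / 2 - 11 * C ^ 2 / 8))))) ∧
        (∀ x, ‖u t x‖ ^ 2 ≤ M / (T - t)) :=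
      fun t ht => ⟨(hb t ht).1, hK t ht, (hb t ht).2.2⟩
    obtain ⟨K', hK'⟩ := enstrophyDecay_step stub_enstrophyLambSlab stub_taoCover hν hT hsol hLH hdec he hb'
    refine ⟨K', fun t ht => (hK' t ht).trans_eq ?_⟩
    congr 3
    rw [bootExp_succ]
    ring
  induction n with
  | zero =>
      have h0 : ∃ K : ℝ, ∀ t ∈ Ioo 0 T,
          ∫⁻ x, ENNReal.ofReal (frobeniusNormSq (fderiv ℝ (u t) x)) ≤
            ENNReal.ofReal (K * (T - t) ^ (-(15 * C ^ 2 / 8 - 3 / 2 + (3 / 5 : ℝ) ^ (0 : ℕ) * (3 / 2 - 11 * C ^ 2 / 8)))) :=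
        ⟨K₂, fun t ht => by rw [bootExp_zero]; exact (hb t ht).2.1⟩
      obtain ⟨K, hK⟩ := h0
      exact ⟨⟨K, hK⟩, step 0 K hK⟩
  | succ n ih =>
      obtain ⟨-, ⟨K, hK⟩⟩ := ih
      have hγ : 0 ≤ (15 * C ^ 2 / 8 - 3 / 2 + (3 / 5 : ℝ) ^ (n + 1) * (3 / 2 - 11 * C ^ 2 / 8)) := by
        have := fixedPoint_le_bootExp hC12 (n + 1)
        nlinarith
      obtain ⟨K', hK'⟩ := zRate_of_Ico hν hT hsol hLH hdec hγ hK
      exact ⟨⟨K', hK'⟩, step (n + 1) K' hK'⟩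

/-- For `C² < 16/15` some bootstrap exponent drops below `1/2` (`β* = 15C²/8 − 3/2 < 1/2`,
`b_n → β*` geometrically). -/
theorem exists_bootExp_lt_half {C : ℝ} (hC : C ^ 2 < 16 / 15) : ∃ n : ℕ, (15 * C ^ 2 / 8 - 3 / 2 + (3 / 5 : ℝ) ^ (n + 1) * (3 / 2 - 11 * C ^ 2 / 8)) < 1 / 2 := by
  have hgap : 0 < 1 / 2 - (15 * C ^ 2 / 8 - 3 / 2) := by linarith
  have hd : 0 < 3 / 2 - 11 * C ^ 2 / 8 + 1 := by nlinarith [sq_nonneg C]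
  obtain ⟨n, hn⟩ := exists_pow_lt_of_lt_one
    (div_pos hgap hd) (by norm_num : (3 / 5 : ℝ) < 1)
  refine ⟨n, ?_⟩
  have h35 : 0 ≤ (3 / 5 : ℝ) ^ (n + 1) := by positivity
  have hle : (3 / 5 : ℝ) ^ (n + 1) ≤ (3 / 5 : ℝ) ^ n := by
    rw [pow_succ]; nlinarith [pow_nonneg (by norm_num : (0:ℝ) ≤ 3 / 5) n]
  have hlt : (3 / 5 : ℝ) ^ (n + 1) * (3 / 2 - 11 * C ^ 2 / 8 + 1) <
      1 / 2 - (15 * C ^ 2 / 8 - 3 / 2) := by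
    have := (lt_div_iff₀ hd).1 (hle.trans_lt hn)
    linarith
  nlinarith [hlt, h35]

/-- **Rungs `X_C` for the FULL `q = 5/2` window `C² < 16/15`** (`√(16/15) = 1.0327…`): every
classical solution of the unforced Navier–Stokes system on `ℝ³ × [0,T)` which is Leray–Hopf from its
rapidly decaying datum and whose collapse Reynolds number is eventually at most `C`,
`√(T−t)‖u(t,x)‖ ≤ C√ν`, extends smoothly past `T`, for every `0 < C` with `C² < 16/15`. For
`C² ≤ 4/5` this is `rung_of_sq_lt` (one step); for `4/5 < C² < 16/15` the bootstrap
`zRate_bootstrap` reaches an `H¹` growth exponent `b_{n+1} < 1/2`, contradicting Tao's `H¹`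
lifespan bound at a singular time (`hasSmoothExtensionPast_of_decay`). This is exactly the window
`(15/16)·(3/2)·C² … ` — `q(q−1)C²/4 < q − 3/2` at `q = 5/2` — of `BudgetCeiling.lean`, now a
kernel theorem; the method's supremum over `q` is `√6 − √2 = 1.0353…` (not reached here). -/
theorem rung_of_sq_lt_window {C : ℝ} (hC0 : 0 < C) (hC : C ^ 2 < 16 / 15) :
    ∀ (ν T : ℝ), 0 < ν → 0 < T →
      ∀ (u : ℝ → EuclideanSpace ℝ (Fin 3) → EuclideanSpace ℝ (Fin 3))
        (p : ℝ → EuclideanSpace ℝ (Fin 3) → ℝ),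
      IsClassicalNSSolutionOn (Set.Ico 0 T) ν 0 u p → IsLerayHopfOn T ν 0 (u 0) u →
      HasRapidSpatialDecay (u 0) →
      (∀ᶠ t in 𝓝[<] T, ∀ x, Real.sqrt (T - t) * ‖u t x‖ ≤ C * Real.sqrt ν) →
      HasSmoothExtensionPast ν 0 u T := by
  intro ν T hν hT u p hcl hLH hdec hrate
  by_cases hC45 : 4 / 5 < C ^ 2
  · have hC12 : C ^ 2 ≤ 12 / 11 := by linarith
    obtain ⟨n, hn⟩ := exists_bootExp_lt_half hC
    obtain ⟨-, ⟨K, hK⟩⟩ := zRate_bootstrap hν hT hC0 hC45 hC12 hcl hLH hdec hrate n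
    exact hasSmoothExtensionPast_of_decay hν hT hcl hLH hdec hn ⟨by linarith, by linarith⟩ hK
  · exact rung_of_sq_lt hC0 (by linarith) ν T hν hT u p hcl hLH hdec hrate

/-- Numerical bracket: `1.0327 < √(16/15) < 1.0328`. -/
theorem sqrt_fullWindow_bounds :
    (1.0327 : ℝ) < Real.sqrt (16 / 15) ∧ Real.sqrt (16 / 15) < 1.0328 := by
  constructor
  · exact (Real.lt_sqrt (by norm_num)).2 (by norm_num)
  · exact (Real.sqrt_lt' (by norm_num)).2 (by norm_num)

/-- **Corollary: rung `X_C` at `C = 1.0327`.** -/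
theorem rung_10327 :
    ∀ (ν T : ℝ), 0 < ν → 0 < T →
      ∀ (u : ℝ → EuclideanSpace ℝ (Fin 3) → EuclideanSpace ℝ (Fin 3))
        (p : ℝ → EuclideanSpace ℝ (Fin 3) → ℝ),
      IsClassicalNSSolutionOn (Set.Ico 0 T) ν 0 u p → IsLerayHopfOn T ν 0 (u 0) u →
      HasRapidSpatialDecay (u 0) →
      (∀ᶠ t in 𝓝[<] T, ∀ x, Real.sqrt (T - t) * ‖u t x‖ ≤ 1.0327 * Real.sqrt ν) →
      HasSmoothExtensionPast ν 0 u T :=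
  rung_of_sq_lt_window (by norm_num) (by norm_num)

end Summit.NavierStokesRegularity.NavierStokesRegularity.Theorems.FiveHalvesWindow

end
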